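import Summits.NavierStokesRegularity.FluidComputer.BlockReachLoading

/-!
# Probing the re-typed residue with one invisible junk mode — a NO-GO for (β) as typed

bp3 gen 35, FLUID COMPUTER lane. HONEST FRAMING: low prior, high value-of-information experiment
on Tao's machine paradigm; NOT a claim that NS blows up. This file proves NOTHING about blow-up
and claims NO residue; every theorem is a CONSEQUENCE of an inhabited
`OpenReachBound 𝒟 P F U ε` (`BlockQuadReach.lean`, bp3 ASK 95), valid for EVERY `F` and `ε`.

`BlockReachRigidity`/`BlockReachLoading` tested `defect` on trajectories from the CLEAN states
`recon n p`; here from `recon n p + δ ψ_k`, `k ∉ {n, n+1}`: ONE extra pure mode, INVISIBLE to the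
readout for all times under the heat flow (disjoint Fourier supports), junk `δ·J(ψ_k)` as small as
we please. Its readout law is the clean law plus `δ`·(cross interactions
`2Re⟨B(recon n p, ψ_k), ψ_m⟩/√E_m`) plus `δ²`·(self terms) (§1); `F p` CANCELS between the two
laws: `‖unit n • (δ L + δ² Q)‖ ≤ 2ε` (§2). The cross term is LINEAR in the amplitudes `(A,B) = p`,
so on a region containing an output ray `{(A₁,B) : B ≥ B₀}` (resp. an input ray)
`Re⟨B(ψ_{n+1},z),ψ_{n+1}⟩ = 0` (resp. `Re⟨B(ψ_n,z),ψ_n⟩ = 0`) for every such probe `z` (§3); with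
`z = ψ_{n+2}` (resp. `ψ_n` at generation `n+1`) and polarisation (§4): `fwdCoef_succ_eq_zero`
**κ_{n+1} = 0 ∀ n**, `backCoef_eq_zero'` **κ'_n = 0 ∀ n**; hence (§5) `norm_sub_damping_le`: with
both rays in `U` the pinned field of `BlockReachRigidity` is PURE VISCOUS DECAY from generation 1
on; `dampedQuad_off`: the lane's damped quadratic gate (β3′a) on the loaded region has **k = 0**.

HONEST READING. A no-go for the local layer (β) AS TYPED in ASK 95 — an instantaneous law demanded
of ALL `H¹⁰_df` data with junk below `jbar √E_n`, absolute tolerance `ε`, on a region unbounded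
along an input and an output ray (the lane's `loadedRegion η` is one) — NOT a statement about
Navier–Stokes: the two-mode truncation is not closed, other modes act on the carrier pair at first
order, and the tree's junk functional `J_{μ,λ_n,s}` prices a pure mode at a finite cost that a
small `δ` makes negligible. For the lane: the residue cannot quantify over arbitrary small junk
with an amplitude-uniform tolerance; a successor must (β″₁) bound the working region in both
amplitudes (then the probe gives a QUANTITATIVE constraint, junk ceiling × amplitude × cross
coefficients ≲ ε/unit, to be typed), or (β″₂) make the tolerance amplitude-relative, or (β″₃)
restrict `defect` to the junk the machine's own dynamics generates (an invariant-class statement —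
the genuinely PDE content). Nothing is discharged; not evidence about NS in either direction.
References: Tao, J. Amer. Math. Soc. 29 (2016), (1.2), (1.3), Lemma 4.1 [cite: Tao2016AveragedNS].
-/

noncomputable section
open MeasureTheory Set Filter Topology Metric
open scoped ENNReal NNReal

namespace Summit.NavierStokesRegularity.FluidComputer
open Literature.Analysis.FluidPDE Literature.Analysis.FluidPDE.Tao2016
open Literature.Analysis.FluidPDE.FluidComputer
open Literature.Analysis.FunctionSpaces (eFourierSobolevNorm)
open Summit.NavierStokesRegularity.NavierStokesRegularity.Theorems.FluidComputer

namespace BlockDesign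

/-! ### §1. The readout law of a true trajectory carrying invisible junk -/

section Perturbed

variable (𝒟 : CascadeWaveletData 1 1) (S : CascadeSpecs)

/-- The DRIVEN two-mode field: readout coordinates `p`, nonlinearity evaluated at the datum `a`:
`(-Λ_n A + Re⟨B(a,a),ψ_n⟩/√E_n, -Λ_{n+1} B + Re⟨B(a,a),ψ_{n+1}⟩/√E_{n+1})`. [folklore] -/
def drivenVF (n : ℕ) (p : ℝ × ℝ) (a : L2C) : ℝ × ℝ :=
  (-(viscRate 𝒟 n * p.1) + (eulerForm a a (mode 𝒟 n)).re / Real.sqrt (S.Emin n),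
    -(viscRate 𝒟 (n + 1) * p.2) +
      (eulerForm a a (mode 𝒟 (n + 1))).re / Real.sqrt (S.Emin (n + 1)))

/-- `⟨u t, ψ_m⟩` along a true mild trajectory from `a = recon n p + w`, junk `w ∈ H¹⁰_df` INVISIBLE
to `ψ_m` under the heat flow: right derivative `⟨recon n p,ψ_m⟩(-Λ_m) + ⟨B(a,a),ψ_m⟩` at `t = 0`.
[folklore] -/
theorem hasDerivWithinAt_coef_perturbed (n m : ℕ) (p : ℝ × ℝ) {w : L2C} (hw : MemH10df w)
    (hwm : ∀ t : ℝ, 0 ≤ t → pairing (heat t w) (mode 𝒟 m) = 0) {S' : ℝ} (hS' : 0 < S')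
    {u : ℝ → L2C} (hu : IsMildSolutionFor eulerForm (recon 𝒟 S n p + w) (Ico 0 S') u) :
    HasDerivWithinAt (fun t => coef 𝒟 m (u t))
      (coef 𝒟 m (recon 𝒟 S n p) * (((-viscRate 𝒟 m : ℝ)) : ℂ) +
        eulerForm (recon 𝒟 S n p + w) (recon 𝒟 S n p + w) (mode 𝒟 m)) (Ici 0) 0 := by
  have hψ10 : MemH10df (mode 𝒟 m) := memH10df_mode 𝒟 m
  have ha : MemH10df (recon 𝒟 S n p + w) := (memH10df_recon 𝒟 S n _).add hw
  have hT₁ : 0 < S' / 2 := by positivity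
  have hsub : Icc 0 (S' / 2) ⊆ Ico 0 S' := fun t ht => ⟨ht.1, lt_of_le_of_lt ht.2 (by linarith)⟩
  have hv : ContinuousInH10On (Icc 0 (S' / 2)) u := hu.2.1.mono hsub
  have hfin : ∀ s ∈ Icc 0 (S' / 2), eFourierSobolevNorm 10 (u s) < ⊤ :=
    fun s hs => (hu.1 s (hsub hs)).1
  obtain ⟨M, hM⟩ := hv.exists_bound hfin
  have hMenn : ∀ s ∈ Icc 0 (S' / 2), eFourierSobolevNorm 10 (u s) ≤ ENNReal.ofReal M := by
    intro s hs
    rw [← ENNReal.ofReal_toReal (hfin s hs).ne]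
    exact ENNReal.ofReal_le_ofReal (hM s hs)
  have hu0 : u 0 = recon 𝒟 S n p + w := initial_eq hu ⟨le_rfl, hS'⟩ ha
  have hD := hasDerivWithinAt_duhamel_zero hT₁ hv hMenn (mode 𝒟 m)
  rw [hu0] at hD
  have hg : HasDerivWithinAt (fun t => coef 𝒟 m (recon 𝒟 S n p) *
      pairing (heat t (mode 𝒟 m)) (mode 𝒟 m) +
      ∫ s in (0:ℝ)..t, eulerForm (u s) (u s) (heat (t - s) (mode 𝒟 m)))
      (coef 𝒟 m (recon 𝒟 S n p) * (((-viscRate 𝒟 m : ℝ)) : ℂ) +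
        eulerForm (recon 𝒟 S n p + w) (recon 𝒟 S n p + w) (mode 𝒟 m)) (Ici 0) 0 :=
    ((hasDerivWithinAt_pairing_heat_mode 𝒟 m).const_mul _).add hD
  have hcoef : ∀ t ∈ Ico 0 S', coef 𝒟 m (u t) = coef 𝒟 m (recon 𝒟 S n p) *
      pairing (heat t (mode 𝒟 m)) (mode 𝒟 m) +
      ∫ s in (0:ℝ)..t, eulerForm (u s) (u s) (heat (t - s) (mode 𝒟 m)) := by
    intro t ht
    rw [coef, hu.2.2 t ht (mode 𝒟 m) hψ10, pairing_heat_left, pairing_add_left,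
      ← pairing_heat_left, ← pairing_heat_left, pairing_heat_recon_mode, hwm t ht.1, add_zero]
  exact ((hg.mono Ico_subset_Ici_self).congr (fun t ht => hcoef t ht) (hcoef 0 ⟨le_rfl, hS'⟩))
    |>.mono_of_mem_nhdsWithin (Ico_mem_nhdsGE hS')

/-- **The readout of a true NS trajectory from a design state carrying invisible junk moves, at
that instant, with the DRIVEN field** `drivenVF n p (recon n p + w)`. [folklore] -/
theorem hasDerivWithinAt_read_perturbed (n : ℕ) (p : ℝ × ℝ) {w : L2C} (hw : MemH10df w)
    (hwn : ∀ t : ℝ, 0 ≤ t → pairing (heat t w) (mode 𝒟 n) = 0)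
    (hwn' : ∀ t : ℝ, 0 ≤ t → pairing (heat t w) (mode 𝒟 (n + 1)) = 0) {S' : ℝ} (hS' : 0 < S')
    {u : ℝ → L2C} (hu : IsMildSolutionFor eulerForm (recon 𝒟 S n p + w) (Ico 0 S') u) :
    HasDerivWithinAt (fun t => read 𝒟 S n (u t)) (drivenVF 𝒟 S n p (recon 𝒟 S n p + w))
      (Ici 0) 0 := by
  have h1 := hasDerivWithinAt_coef_perturbed 𝒟 S n n p hw hwn hS' hu
  have h2 := hasDerivWithinAt_coef_perturbed 𝒟 S n (n + 1) p hw hwn' hS' hu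
  rw [coef_recon_self] at h1
  rw [coef_recon_succ] at h2
  have k1 := hasDerivWithinAt_re_div_const h1 (Real.sqrt (S.Emin n))
  have k2 := hasDerivWithinAt_re_div_const h2 (Real.sqrt (S.Emin (n + 1)))
  have hE := (sqrt_Emin_pos S n).ne'; have hE' := (sqrt_Emin_pos S (n + 1)).ne'
  have hv1 : ((((p.1 * Real.sqrt (S.Emin n) : ℝ) : ℂ) * (((-viscRate 𝒟 n : ℝ)) : ℂ) +
      eulerForm (recon 𝒟 S n p + w) (recon 𝒟 S n p + w) (mode 𝒟 n)).re) /
        Real.sqrt (S.Emin n) = (drivenVF 𝒟 S n p (recon 𝒟 S n p + w)).1 := by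
    rw [Complex.add_re, ← Complex.ofReal_mul, Complex.ofReal_re]
    simp only [drivenVF]
    field_simp
  have hv2 : ((((p.2 * Real.sqrt (S.Emin (n + 1)) : ℝ) : ℂ) * (((-viscRate 𝒟 (n + 1) : ℝ)) : ℂ) +
      eulerForm (recon 𝒟 S n p + w) (recon 𝒟 S n p + w) (mode 𝒟 (n + 1))).re) /
        Real.sqrt (S.Emin (n + 1)) = (drivenVF 𝒟 S n p (recon 𝒟 S n p + w)).2 := by
    rw [Complex.add_re, ← Complex.ofReal_mul, Complex.ofReal_re]
    simp only [drivenVF]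
    field_simp
  rw [hv1] at k1; rw [hv2] at k2; exact k1.prodMk k2

/-- The PROBE VECTOR, linear part: `2Re⟨B(recon n p, z), ψ_m⟩/√E_m`, `m = n, n+1`. [folklore] -/
def probeL (n : ℕ) (p : ℝ × ℝ) (z : L2C) : ℝ × ℝ :=
  (2 * (eulerForm (recon 𝒟 S n p) z (mode 𝒟 n)).re / Real.sqrt (S.Emin n),
    2 * (eulerForm (recon 𝒟 S n p) z (mode 𝒟 (n + 1))).re / Real.sqrt (S.Emin (n + 1)))

/-- The PROBE VECTOR, quadratic part: `Re⟨B(z,z), ψ_m⟩/√E_m`, `m = n, n+1`. [folklore] -/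
def probeQ (n : ℕ) (z : L2C) : ℝ × ℝ :=
  ((eulerForm z z (mode 𝒟 n)).re / Real.sqrt (S.Emin n),
    (eulerForm z z (mode 𝒟 (n + 1))).re / Real.sqrt (S.Emin (n + 1)))

/-- Real part of the binomial expansion `⟨B(x+by, x+by), w⟩`. [folklore] -/
theorem re_eulerForm_add_smul_self {x y : L2C} (hx : MemH10df x) (hy : MemH10df y) (b : ℝ)
    (w : L2C) : (eulerForm (x + (b : ℂ) • y) (x + (b : ℂ) • y) w).re =
      (eulerForm x x w).re + 2 * b * (eulerForm x y w).re + b ^ 2 * (eulerForm y y w).re := by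
  rw [eulerForm_add_smul_self hx hy b w]
  have h2 : (2 : ℂ) * (b : ℂ) * eulerForm x y w = (((2 * b : ℝ)) : ℂ) * eulerForm x y w := by
    push_cast; ring
  rw [h2, ← Complex.ofReal_pow, Complex.add_re, Complex.add_re, Complex.re_ofReal_mul,
    Complex.re_ofReal_mul]

/-- **The driven field at `recon n p + δ z` is the Galerkin–NS field plus `δ`·probe plus
`δ²`·self-term.** [folklore] -/
theorem drivenVF_perturbed (n : ℕ) (p : ℝ × ℝ) {z : L2C} (hz : MemH10df z) (δ : ℝ) :
    drivenVF 𝒟 S n p (recon 𝒟 S n p + (δ : ℂ) • z) =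
      nsVF 𝒟 S n p + δ • probeL 𝒟 S n p z + δ ^ 2 • probeQ 𝒟 S n z := by
  have hE := (sqrt_Emin_pos S n).ne'; have hE' := (sqrt_Emin_pos S (n + 1)).ne'
  simp only [drivenVF, nsVF, probeL, probeQ, re_eulerForm_add_smul_self (memH10df_recon 𝒟 S n p) hz,
    Prod.smul_mk, Prod.mk_add_mk, smul_eq_mul, Prod.mk.injEq]
  constructor <;> (field_simp; ring)

/-- `Re⟨B(recon n p, z), w⟩ = A√E_n Re⟨B(ψ_n,z),w⟩ + B√E_{n+1} Re⟨B(ψ_{n+1},z),w⟩`: the probe is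
LINEAR in the amplitudes. [folklore] -/
theorem re_eulerForm_recon_left (n : ℕ) (p : ℝ × ℝ) {z : L2C} (hz : MemH10df z) (w : L2C) :
    (eulerForm (recon 𝒟 S n p) z w).re =
      p.1 * Real.sqrt (S.Emin n) * (eulerForm (mode 𝒟 n) z w).re +
        p.2 * Real.sqrt (S.Emin (n + 1)) * (eulerForm (mode 𝒟 (n + 1)) z w).re := by
  have h1 : MemH10df ((((p.1 * Real.sqrt (S.Emin n) : ℝ)) : ℂ) • mode 𝒟 n) :=
    (memH10df_mode 𝒟 n).smul _
  unfold recon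
  rw [eulerForm_add_smul₁ _ w h1.1 (memH10df_mode 𝒟 (n + 1)).1 hz.1, eulerForm_smul₁,
    Complex.add_re, Complex.re_ofReal_mul, Complex.re_ofReal_mul]

end Perturbed

/-! ### §2. What an inhabited residue says about the probe -/

variable {𝒟 : CascadeWaveletData 1 1} {S : CascadeSpecs} {P : Params S}
variable {F : ℝ × ℝ → ℝ × ℝ} {U : Set (ℝ × ℝ)} {ε : ℝ}

/-- A bound `|q B + r| ≤ c` along a ray forces `q = 0`. [folklore] -/
theorem eq_zero_of_abs_mul_add_le_of_ray {q r B₀ c : ℝ}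
    (h : ∀ B : ℝ, B₀ ≤ B → |q * B + r| ≤ c) : q = 0 :=
  eq_zero_of_abs_mul_le_of_ray (A₀ := B₀) (c := c + |r|) fun B hB => by
    have h2 := abs_add_le (q * B + r) (-r)
    rw [abs_neg, add_neg_cancel_right] at h2
    linarith [h B hB]

/-- A pure mode has finite junk at every block (`J_{μ,λ_n,s}(ψ_k) < ∞`). [folklore] -/
theorem J_mode_lt_top (n k : ℕ) : J P.μ (S.lam n) P.s (mode 𝒟 k) < ⊤ := by
  set M' : ℝ := (max ((2 : ℝ) ^ k * (3 / 2)) P.μ / S.lam n) ^ P.s with hM'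
  have hκ : 0 < S.lam n := by rw [P.lam_eq]; positivity
  have hMW : ∀ ξ ∈ freqRegion 𝒟 0 (k : ℤ), (max ‖ξ‖ P.μ / S.lam n) ^ P.s ≤ M' := by
    intro ξ hξ
    have h1 := (norm_of_mem_region 𝒟 k hξ).2
    exact Real.rpow_le_rpow (div_nonneg ((norm_nonneg ξ).trans (le_max_left _ _)) hκ.le)
      (div_le_div_of_nonneg_right (max_le_max_right _ h1) hκ.le) P.s_nonneg
  have h := J_smul_wavelet_le 𝒟 two_pos' 0 (k : ℤ) hMW (1 : ℂ)
  rw [one_smul, enorm_one, one_mul] at h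
  exact lt_of_le_of_lt h ENNReal.ofReal_lt_top

/-- A small enough multiple of a finite-junk direction stays under the residue's junk ceiling.
[folklore] -/
theorem OpenReachBound.exists_probe_scale (H : OpenReachBound 𝒟 P F U ε) (n : ℕ) {z : L2C}
    (hJ : J P.μ (S.lam n) P.s z < ⊤) : ∃ δ : ℝ, 0 < δ ∧
      ENNReal.ofReal |δ| * J P.μ (S.lam n) P.s z <
        ENNReal.ofReal (H.jbar * Real.sqrt (S.Emin n)) := by
  set j : ℝ := (J P.μ (S.lam n) P.s z).toReal with hj
  have hj0 : 0 ≤ j := ENNReal.toReal_nonneg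
  have hJe : J P.μ (S.lam n) P.s z = ENNReal.ofReal j := (ENNReal.ofReal_toReal hJ.ne).symm
  have hc : 0 < H.jbar * Real.sqrt (S.Emin n) :=
    mul_pos (P.jrun_pos.trans H.jrun_lt_jbar) (sqrt_Emin_pos S n)
  refine ⟨H.jbar * Real.sqrt (S.Emin n) / (2 * (j + 1)), by positivity, ?_⟩
  rw [hJe, ← ENNReal.ofReal_mul (abs_nonneg _), ENNReal.ofReal_lt_ofReal_iff hc,
    abs_of_pos (by positivity), div_mul_eq_mul_div, div_lt_iff₀ (by positivity)]
  nlinarith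

/-- **THE PROBE INEQUALITY** `‖unit n • (δ • probeL n p z + δ² • probeQ n z)‖ ≤ 2ε` for `p ∈ U`,
`z ∈ H¹⁰_df` invisible to `ψ_n, ψ_{n+1}` under the heat flow, `|δ| J(z) < jbar √E_n`: the laws at
`t = 0` on the true trajectories from `recon n p` and `recon n p + δ z` have the SAME readout `p`,
both junks under the ceiling, and `F p` cancels — for EVERY `F`, `ε`. [folklore] -/
theorem OpenReachBound.norm_probe_le (H : OpenReachBound 𝒟 P F U ε) (n : ℕ) {p : ℝ × ℝ}
    (hp : p ∈ U) {z : L2C} (hz : MemH10df z)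
    (hzn : ∀ t : ℝ, 0 ≤ t → pairing (heat t z) (mode 𝒟 n) = 0)
    (hzn' : ∀ t : ℝ, 0 ≤ t → pairing (heat t z) (mode 𝒟 (n + 1)) = 0) {δ : ℝ}
    (hδ : ENNReal.ofReal |δ| * J P.μ (S.lam n) P.s z <
      ENNReal.ofReal (H.jbar * Real.sqrt (S.Emin n))) :
    ‖H.unit n • (δ • probeL 𝒟 S n p z + δ ^ 2 • probeQ 𝒟 S n z)‖ ≤ 2 * ε := by
  set w : L2C := (δ : ℂ) • z with hwdef
  have hw : MemH10df w := hz.smul δ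
  have hwn : ∀ t : ℝ, 0 ≤ t → pairing (heat t w) (mode 𝒟 n) = 0 := fun t ht => by
    rw [hwdef, pairing_heat_left, pairing_smul_left, ← pairing_heat_left, hzn t ht, mul_zero]
  have hwn' : ∀ t : ℝ, 0 ≤ t → pairing (heat t w) (mode 𝒟 (n + 1)) = 0 := fun t ht => by
    rw [hwdef, pairing_heat_left, pairing_smul_left, ← pairing_heat_left, hzn' t ht, mul_zero]
  have ha : MemH10df (recon 𝒟 S n p + w) := (memH10df_recon 𝒟 S n p).add hw
  obtain ⟨T, hT, u, hu⟩ := h10MildTheory_holds.localExistence _ ha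
  have hu0 : u 0 = recon 𝒟 S n p + w := initial_eq hu ⟨le_rfl, hT⟩ ha
  have h0n : coef 𝒟 n w = 0 := by simpa only [heat_zero, coef] using hwn 0 le_rfl
  have h0n' : coef 𝒟 (n + 1) w = 0 := by simpa only [heat_zero, coef] using hwn' 0 le_rfl
  have hread : read 𝒟 S n (u 0) = p := by
    have e : read 𝒟 S n (recon 𝒟 S n p + w) = read 𝒟 S n (recon 𝒟 S n p) := by
      simp only [read, coef_add, h0n, h0n', add_zero]
    rw [hu0, e, read_recon]
  have hjunk : junk 𝒟 P n (u 0) < ENNReal.ofReal (H.jbar * Real.sqrt (S.Emin n)) := by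
    rw [hu0]
    refine lt_of_le_of_lt (junk_le (𝒟 := 𝒟) (P := P) n _ p) ?_
    have hn : ‖((δ : ℝ) : ℂ)‖ₑ = ENNReal.ofReal |δ| := by
      rw [← ofReal_norm, Complex.norm_real, Real.norm_eq_abs]
    rw [add_sub_cancel_left, hwdef, J_smul, hn]
    exact hδ
  obtain ⟨W, hW, hWε⟩ := H.defect n _ T u hu 0 le_rfl hT (hread ▸ hp) hjunk
  have hEq : W = drivenVF 𝒟 S n p (recon 𝒟 S n p + w) :=
    (uniqueDiffOn_Ici (0 : ℝ) 0 (Set.mem_Ici.2 le_rfl)).eq_deriv _ hW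
      (hasDerivWithinAt_read_perturbed 𝒟 S n p hw hwn hwn' hT hu)
  rw [hread, hEq, hwdef, drivenVF_perturbed 𝒟 S n p hz δ] at hWε
  have h0 := H.norm_unit_smul_nsVF_sub_le n hp
  have e : H.unit n • (δ • probeL 𝒟 S n p z + δ ^ 2 • probeQ 𝒟 S n z) =
      (H.unit n • (nsVF 𝒟 S n p + δ • probeL 𝒟 S n p z + δ ^ 2 • probeQ 𝒟 S n z) - F p) -
        (H.unit n • nsVF 𝒟 S n p - F p) := by
    simp only [smul_add]
    abel
  rw [e]; exact (norm_sub_le _ _).trans (by linarith)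

/-! ### §3. Rays: the cross interactions of the carrier pair with every probe must vanish -/

/-- OUTPUT RAY ⇒ `Re⟨B(ψ_{n+1}, z), ψ_{n+1}⟩ = 0` for every admissible probe `z` (the coefficient
of `B` in the output component of the probe inequality). [folklore] -/
theorem OpenReachBound.re_out_probe_out (H : OpenReachBound 𝒟 P F U ε) (n : ℕ) {A₁ B₀ : ℝ}
    (hU : ∀ B : ℝ, B₀ ≤ B → ((A₁, B) : ℝ × ℝ) ∈ U) {z : L2C} (hz : MemH10df z)
    (hzn : ∀ t : ℝ, 0 ≤ t → pairing (heat t z) (mode 𝒟 n) = 0)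
    (hzn' : ∀ t : ℝ, 0 ≤ t → pairing (heat t z) (mode 𝒟 (n + 1)) = 0)
    (hJ : J P.μ (S.lam n) P.s z < ⊤) :
    (eulerForm (mode 𝒟 (n + 1)) z (mode 𝒟 (n + 1))).re = 0 := by
  obtain ⟨δ, hδ, hδJ⟩ := H.exists_probe_scale n hJ
  suffices hq : H.unit n * (δ * (2 * (eulerForm (mode 𝒟 (n + 1)) z (mode 𝒟 (n + 1))).re)) = 0 by
    linarith [(mul_eq_zero.1 ((mul_eq_zero.1 hq).resolve_left (H.unit_pos n).ne')).resolve_left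
      hδ.ne']
  refine eq_zero_of_abs_mul_add_le_of_ray (B₀ := B₀) (c := 2 * ε)
    (r := H.unit n * (δ * (2 * (A₁ * Real.sqrt (S.Emin n) *
      (eulerForm (mode 𝒟 n) z (mode 𝒟 (n + 1))).re) / Real.sqrt (S.Emin (n + 1))) +
      δ ^ 2 * (probeQ 𝒟 S n z).2)) fun B hB => ?_
  have h := (norm_snd_le _).trans (H.norm_probe_le n (hU B hB) hz hzn hzn' hδJ)
  have hE' := (sqrt_Emin_pos S (n + 1)).ne'
  have e : (H.unit n • (δ • probeL 𝒟 S n (A₁, B) z + δ ^ 2 • probeQ 𝒟 S n z)).2 =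
      H.unit n * (δ * (2 * (eulerForm (mode 𝒟 (n + 1)) z (mode 𝒟 (n + 1))).re)) * B +
        (H.unit n * (δ * (2 * (A₁ * Real.sqrt (S.Emin n) *
          (eulerForm (mode 𝒟 n) z (mode 𝒟 (n + 1))).re) / Real.sqrt (S.Emin (n + 1))) +
          δ ^ 2 * (probeQ 𝒟 S n z).2)) := by
    simp only [Prod.snd_add, Prod.smul_snd, smul_eq_mul, probeL,
      re_eulerForm_recon_left 𝒟 S n _ hz]
    field_simp
    ring
  rwa [Real.norm_eq_abs, e] at h

/-- INPUT RAY ⇒ `Re⟨B(ψ_n, z), ψ_n⟩ = 0` for every admissible probe `z` (the coefficient of `A`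
in the input component of the probe inequality). [folklore] -/
theorem OpenReachBound.re_in_probe_in (H : OpenReachBound 𝒟 P F U ε) (n : ℕ) {A₀ B₁ : ℝ}
    (hU : ∀ A : ℝ, A₀ ≤ A → ((A, B₁) : ℝ × ℝ) ∈ U) {z : L2C} (hz : MemH10df z)
    (hzn : ∀ t : ℝ, 0 ≤ t → pairing (heat t z) (mode 𝒟 n) = 0)
    (hzn' : ∀ t : ℝ, 0 ≤ t → pairing (heat t z) (mode 𝒟 (n + 1)) = 0)
    (hJ : J P.μ (S.lam n) P.s z < ⊤) :
    (eulerForm (mode 𝒟 n) z (mode 𝒟 n)).re = 0 := by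
  obtain ⟨δ, hδ, hδJ⟩ := H.exists_probe_scale n hJ
  suffices hq : H.unit n * (δ * (2 * (eulerForm (mode 𝒟 n) z (mode 𝒟 n)).re)) = 0 by
    linarith [(mul_eq_zero.1 ((mul_eq_zero.1 hq).resolve_left (H.unit_pos n).ne')).resolve_left
      hδ.ne']
  refine eq_zero_of_abs_mul_add_le_of_ray (B₀ := A₀) (c := 2 * ε)
    (r := H.unit n * (δ * (2 * (B₁ * Real.sqrt (S.Emin (n + 1)) *
      (eulerForm (mode 𝒟 (n + 1)) z (mode 𝒟 n)).re) / Real.sqrt (S.Emin n)) +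
      δ ^ 2 * (probeQ 𝒟 S n z).1)) fun A hA => ?_
  have h := (norm_fst_le _).trans (H.norm_probe_le n (hU A hA) hz hzn hzn' hδJ)
  have hE := (sqrt_Emin_pos S n).ne'
  have e : (H.unit n • (δ • probeL 𝒟 S n (A, B₁) z + δ ^ 2 • probeQ 𝒟 S n z)).1 =
      H.unit n * (δ * (2 * (eulerForm (mode 𝒟 n) z (mode 𝒟 n)).re)) * A +
        (H.unit n * (δ * (2 * (B₁ * Real.sqrt (S.Emin (n + 1)) *
          (eulerForm (mode 𝒟 (n + 1)) z (mode 𝒟 n)).re) / Real.sqrt (S.Emin n)) +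
          δ ^ 2 * (probeQ 𝒟 S n z).1)) := by
    simp only [Prod.fst_add, Prod.smul_fst, smul_eq_mul, probeL,
      re_eulerForm_recon_left 𝒟 S n _ hz]
    field_simp
    ring
  rwa [Real.norm_eq_abs, e] at h

/-! ### §4. Probing by pure modes: all nearest-neighbour couplings vanish -/

/-- Real form of the polarised cancellation law: `Re⟨B(x,x),y⟩ = -2 Re⟨B(x,y),x⟩`.
[cite: Tao2016AveragedNS, (1.2), (1.3)] -/
theorem re_eulerForm_self_eq_polar {x y : L2C} (hx : MemH10df x) (hy : MemH10df y) :
    (eulerForm x x y).re = -2 * (eulerForm x y x).re := by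
  have h := eulerForm_polar hx hy
  have h' : eulerForm x x y = (((-2 : ℝ)) : ℂ) * eulerForm x y x := by
    push_cast
    linear_combination h
  rw [h', Complex.re_ofReal_mul]

/-- **κ_{n+1} = 0 FOR EVERY n** if `U` contains an output ray `{(A₁,B) : B ≥ B₀}` (probe
`z = ψ_{n+2}` at generation `n`, polarisation) — for EVERY `F` and `ε`. [folklore] -/
theorem OpenReachBound.fwdCoef_succ_eq_zero (H : OpenReachBound 𝒟 P F U ε) {A₁ B₀ : ℝ}
    (hU : ∀ B : ℝ, B₀ ≤ B → ((A₁, B) : ℝ × ℝ) ∈ U) (n : ℕ) : fwdCoef 𝒟 (n + 1) = 0 := by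
  have hz : MemH10df (mode 𝒟 (n + 1 + 1)) := memH10df_mode 𝒟 (n + 1 + 1)
  have h := H.re_out_probe_out n hU hz
    (fun t _ => pairing_heat_mode_of_ne 𝒟 (by omega : n + 1 + 1 ≠ n) t)
    (fun t _ => pairing_heat_mode_of_ne 𝒟 (by omega : n + 1 + 1 ≠ n + 1) t)
    (J_mode_lt_top n (n + 1 + 1))
  rw [fwdCoef, re_eulerForm_self_eq_polar (memH10df_mode 𝒟 (n + 1)) hz, h, mul_zero]

/-- **κ'_n = 0 FOR EVERY n** if `U` contains an input ray `{(A,B₁) : A ≥ A₀}` (probe `z = ψ_n` at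
generation `n+1`, polarisation) — for EVERY `F` and `ε`; compare `OpenReachBound.backCoef_eq_zero`,
which needed a growth hypothesis on `F`. [folklore] -/
theorem OpenReachBound.backCoef_eq_zero' (H : OpenReachBound 𝒟 P F U ε) {A₀ B₁ : ℝ}
    (hU : ∀ A : ℝ, A₀ ≤ A → ((A, B₁) : ℝ × ℝ) ∈ U) (n : ℕ) : backCoef 𝒟 n = 0 := by
  have hz : MemH10df (mode 𝒟 n) := memH10df_mode 𝒟 n
  have h := H.re_in_probe_in (n + 1) hU hz
    (fun t _ => pairing_heat_mode_of_ne 𝒟 (by omega : n ≠ n + 1) t)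
    (fun t _ => pairing_heat_mode_of_ne 𝒟 (by omega : n ≠ n + 1 + 1) t)
    (J_mode_lt_top (n + 1) n)
  rw [backCoef, re_eulerForm_self_eq_polar (memH10df_mode 𝒟 (n + 1)) hz, h, mul_zero]

/-! ### §5. Consequences: the pinned field is pure viscous decay; the damped gate is OFF -/

/-- **THE PINNED FIELD IS PURE VISCOUS DECAY from generation 1 on**: with an input and an output
ray in `U`, `‖F p - unit (n+1) • (-Λ_{n+1} A, -Λ_{n+2} B)‖ ≤ ε` on `U`, whatever `F` is.
[folklore] -/
theorem OpenReachBound.norm_sub_damping_le (H : OpenReachBound 𝒟 P F U ε) {A₀ A₁ B₀ B₁ : ℝ}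
    (hUout : ∀ B : ℝ, B₀ ≤ B → ((A₁, B) : ℝ × ℝ) ∈ U)
    (hUin : ∀ A : ℝ, A₀ ≤ A → ((A, B₁) : ℝ × ℝ) ∈ U) (n : ℕ) {p : ℝ × ℝ} (hp : p ∈ U) :
    ‖F p - H.unit (n + 1) •
        ((-(viscRate 𝒟 (n + 1) * p.1), -(viscRate 𝒟 (n + 1 + 1) * p.2)) : ℝ × ℝ)‖ ≤ ε := by
  have hκ := H.fwdCoef_succ_eq_zero hUout n
  have hκ' := H.backCoef_eq_zero' hUin (n + 1)
  have e : nsVF 𝒟 S (n + 1) p =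
      (-(viscRate 𝒟 (n + 1) * p.1), -(viscRate 𝒟 (n + 1 + 1) * p.2)) := by
    rw [nsVF_eq, hκ, hκ']
    simp
  have h := H.norm_unit_smul_nsVF_sub_le (n + 1) hp
  rwa [e, ← norm_neg, neg_sub] at h

/-- **THE DAMPED QUADRATIC GATE MUST BE OFF**: for the lane's gate (β3′a) `dampedQuadVF k η γ γ'`
on `loadedRegion η` (`η ≥ 1/2`) an inhabited residue forces `k = 0` (`k = unit 1·E_1 κ_1/√E_2` by
`BlockReachRigidity`, `κ_1 = 0` by §4 on the output ray `{(2, B)}`). [folklore] -/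
theorem OpenReachBound.dampedQuad_off {k η γ γ' : ℝ} (hη : 1 / 2 ≤ η)
    (H : OpenReachBound 𝒟 P (dampedQuadVF k η γ γ') (loadedRegion η) ε) : k = 0 := by
  have hk := (H.dampedQuad_constants_loaded hη 1).2.2.1
  have hκ : fwdCoef 𝒟 1 = 0 := by
    simpa using H.fwdCoef_succ_eq_zero (A₁ := 2) (B₀ := 0)
      (fun B _ => mem_loadedRegion_of_two_le (by linarith : (0 : ℝ) ≤ η) le_rfl B) 0
  rw [hk, hκ, mul_zero, zero_div]

/-- Equivalently: the damped quadratic gate with `k ≠ 0` admits NO re-typed residue on the loaded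
region, at any tolerance `ε` and any damping `γ, γ'`. [folklore] -/
theorem not_openReachBound_dampedQuad {k η γ γ' : ℝ} (hη : 1 / 2 ≤ η) (hk : k ≠ 0) :
    IsEmpty (OpenReachBound 𝒟 P (dampedQuadVF k η γ γ') (loadedRegion η) ε) :=
  ⟨fun H => hk (H.dampedQuad_off hη)⟩

end BlockDesign

end Summit.NavierStokesRegularity.FluidComputer

end
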